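import Summits.QuantumFields.YangMills.Theorems.SwapVirialDeficitPeriodicFixedLRung
import HarnessLib

/-!
# The PERIODIC massive-mode rung AT FIXED `L`: the principal log-limit as a THEOREM and its three fixed-`L` shadows of the crux statements
# (free-hands support of ⟨stmt-QuantumFields-24196⟩ `SwapVirialDeficit.ToronSoftnessSharp`; LEAD memo `sfw-p2-g96-memo-24196-PM-design.md` §6; consumes
# ✓(B2) `…PeriodicFixedLRung` and w3 g64's fixed-`L` consumers in `…PeriodicRingMeanActionFixedLLimit` / `…FixedLRelativeGapOfLimits`)

* ★★★★ `periodicPrincipalLogLimit_fixedL (L)` — for every `L ≥ 1` there is `v > 0` with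
  `μ_L.real{F₀ ≤ s}/(s^{9L⁴−3/2}·log s⁻¹) → v` as `s → 0⁺` (the zero-flux ring's principal small-ball law WITH its logarithm), unconditionally
  (✓`periodicPrincipalLogLimit_of_twoScale_ae` at a product-good level, data of ✓`relativeGap_fixedL_periodic`);
* ★★★★ `toronSoftness_fixedL (hε) : ∃ L₀, ∀ L ≥ L₀, ∃ β₀, ∀ β ≥ β₀, 12βL⁴ − 9L⁴ + 3/2 − ε ≤ β·(log physTrace_L(β, 2L))′` — the FIXED-`L` SHADOW of the crux
  ⟨24196⟩ `ToronSoftnessSharp` (same inequality; the crux asks for it UNIFORMLY on windows `L₀ ≤ L ≤ β^a`) via ✓`periodicPhysTraceSoftness_fixedL_of_principalLogLimit`;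
* ★★★ `periodicSoftness_fixedL (L) (hε)` — two-sided fixed-`L` mean action of the untwisted sector, ★★★ `gibbsMean_ringDeficit_fixedL (L)` — `b·⟨F₀⟩_b → 9L⁴ − 3/2`.
HONEST LABEL: fixed `L`, `β → ∞` (plan-level rung of a DRAFT line); the window-uniform statements ⟨24196⟩ ⟨24194⟩ ⟨24197⟩ ⟨24497⟩ remain OPEN (a fixed-`L`
`β₀(L)` with no growth control does NOT give a window `L ≤ β^a`); own crux ⟨22884⟩ OPEN (blocked-on ⟨19935⟩); the Yang–Mills mass gap is NOT proved;
no summit is proved by a line.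
LEAD seat ym-line-sfw-p2 g96 (cell ym-idea-1, free hands), `--supports stmt-QuantumFields-24196`.  THEOREMS ONLY, standard axioms, 0 `sorry`.
References: [cite: Luscher1983, §2]; [cite: GonzalezarroyoAltes1988]; [cite: tHooft1979]; [cite: CosteEtAl1985]; [folklore].
-/

set_option autoImplicit false
set_option synthInstance.maxSize 1024

noncomputable section

open MeasureTheory Quaternion Set Filter Topology
open scoped Quaternion ENNReal BigOperators
open Literature.MathematicalPhysics.QuantumLattice
open Literature.MathematicalPhysics.QuantumFieldTheory hiding SU2
open Summit.QuantumFields.YangMills.Theorems.SwapTwistDeficit.ToronLog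

attribute [local instance] Literature.Analysis.FluidPDE.Tao2016.quatMeasurableSpace
  Literature.Analysis.FluidPDE.Tao2016.quatBorelSpace
  Literature.MathematicalPhysics.QuantumLattice.secondCountableTopology_su2

namespace Summit.QuantumFields.YangMills.Theorems.SwapVirialDeficit.BlowUpRing

open Summit.QuantumFields.YangMills.Theorems.FemtoTransferGap
open Summit.QuantumFields.YangMills.Theorems.FemtoTransferGap.TT
open Summit.QuantumFields.YangMills.Theorems.VirialFluxGap.RingDeficit
open Summit.QuantumFields.YangMills.Theorems.SwapVirialDeficit.PeriodicRing (periodicSoftness_fixedL_of_principalLogLimit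
  tendsto_gibbsMean_of_principalLogLimit periodicPhysTraceSoftness_fixedL_of_principalLogLimit)

variable {L : ℕ} [NeZero L]

/-- ★★★★ **THE PRINCIPAL ZERO-FLUX LOG-LIMIT AT FIXED `L` — A THEOREM**: for every `L ≥ 1` there is `v > 0` with
`μ_L.real{F₀ ≤ s}/(s^{9L⁴−3/2}·log s⁻¹) → v` (`s → 0⁺`). [cite: Luscher1983, §2] [cite: GonzalezarroyoAltes1988] -/
theorem periodicPrincipalLogLimit_fixedL (L : ℕ) [NeZero L] :
    ∃ v : ℝ, 0 < v ∧
      Tendsto (fun s : ℝ => (ringMeasure L).real {P | ringDeficit L (fun _ => false) P ≤ s} / (s ^ (9 * (L : ℝ) ^ 4 - 3 / 2) * Real.log s⁻¹))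
        (𝓝[>] 0) (𝓝 v) := by
  obtain ⟨r, hr, hnull⟩ := exists_good_level (L := L)
  have hr0 : 0 < r := by linarith [hr.1]
  have hr1 : r ≤ 1 := hr.2.le
  have hMmax : muXi L (twoScaleDom L) ≠ ∞ := volume_twoScaleDominator_lt_top.ne
  have h0 : ∀ᵐ a₀ : ℝ ∂(volume : Measure ℝ), a₀ ≠ 0 := by
    rw [ae_iff]; simp
  have hlim : ∀ᵐ a₀ : ℝ ∂(volume : Measure ℝ), a₀ ^ 2 < 1 →
      Tendsto (fun p : ℝ × ℝ => twoScaleVolumeR L r p.1 p.2 a₀) (𝓝[>] (0 : ℝ) ×ˢ 𝓝[>] (0 : ℝ)) (𝓝 (muXi L (twoScaleLimitSet L r a₀))) := by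
    filter_upwards [hnull, h0] with a₀ hn ha h1
    exact tendsto_twoScaleVolumeR_of_null hr0 hr1 ha ((sq_lt_one_iff_abs_lt_one a₀).1 h1).le hn
  have hgI := relativeGap_fixedL_periodic.lintegral_limit_pos (L := L) hr0 hMmax
  refine ⟨_, ?_, periodicPrincipalLogLimit_of_twoScale_ae L hr0 hMmax (fun a₀ => measure_twoScaleLimitSet_le r a₀)
    (fun u s => measurable_twoScaleVolumeR_hub r u s) hlim⟩
  have h1 : 0 < r ^ (9 * (L : ℝ) ^ 4 - 3 / 2) := Real.rpow_pos_of_pos hr0 _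
  have h2 : 0 < coneConst := coneConst_pos
  positivity

/-- ★★★★ **TORON SOFTNESS AT FIXED `L` — the fixed-`L` shadow of crux ⟨24196⟩ `ToronSoftnessSharp`**: for every `ε > 0` there is `L₀` such that for
every `L ≥ L₀`: `∃ β₀, ∀ β ≥ β₀, 12βL⁴ − 9L⁴ + 3/2 − ε ≤ β·(log physTrace_L(β, 2L))′`.  HONEST LABEL: `β₀ = β₀(L)`; NOT the window statement.
[cite: tHooft1979] [cite: Luscher1983, §2] [cite: CosteEtAl1985] -/
theorem toronSoftness_fixedL {ε : ℝ} (hε : 0 < ε) :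
    ∃ L₀ : ℕ, ∀ (L : ℕ) [NeZero L], L₀ ≤ L →
      ∃ β₀ : ℝ, ∀ β : ℝ, β₀ ≤ β →
        12 * β * (L : ℝ) ^ 4 - 9 * (L : ℝ) ^ 4 + 3 / 2 - ε ≤ β * deriv (fun b : ℝ => Real.log (TT.physTrace L b (2 * L))) β := by
  obtain ⟨L₀, h⟩ := periodicPhysTraceSoftness_fixedL_of_principalLogLimit hε
  refine ⟨L₀, fun L _ hL => ?_⟩
  obtain ⟨v, hv, hlim⟩ := periodicPrincipalLogLimit_fixedL L
  exact h L hL hv hlim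

/-- ★★★ **Two-sided fixed-`L` mean action of the untwisted sector**: for every `L ≥ 1` and `ε > 0`, eventually in `b`,
`12bL⁴ − 9L⁴ + 3/2 − ε ≤ b·(log sectorWeight_L(b))′ ≤ 12bL⁴ − 9L⁴ + 3/2 + ε`. [cite: Luscher1983, §2] -/
theorem periodicSoftness_fixedL (L : ℕ) [NeZero L] {ε : ℝ} (hε : 0 < ε) :
    ∃ β₀ : ℝ, ∀ b : ℝ, β₀ ≤ b →
      12 * b * (L : ℝ) ^ 4 - 9 * (L : ℝ) ^ 4 + 3 / 2 - ε ≤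
          b * deriv (fun x : ℝ => Real.log (TT.sectorWeight (L := L) x (2 * L - 1) (fun _ => false) (fun _ _ => (1 : ℝ)))) b ∧
      b * deriv (fun x : ℝ => Real.log (TT.sectorWeight (L := L) x (2 * L - 1) (fun _ => false) (fun _ _ => (1 : ℝ)))) b ≤
          12 * b * (L : ℝ) ^ 4 - 9 * (L : ℝ) ^ 4 + 3 / 2 + ε := by
  obtain ⟨v, hv, hlim⟩ := periodicPrincipalLogLimit_fixedL L
  exact periodicSoftness_fixedL_of_principalLogLimit L hv hlim hε

/-- ★★★ **The Gibbs mean of the zero-flux ring deficit at fixed `L`**: `b·⟨F₀⟩_b → 9L⁴ − 3/2` as `b → ∞` — the `3/2` is the toron softness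
(moduli + valley + the logarithm, which does not shift the exponent). [cite: Luscher1983, §2] [cite: GonzalezarroyoAltes1988] -/
theorem gibbsMean_ringDeficit_fixedL (L : ℕ) [NeZero L] :
    Tendsto (fun b : ℝ => b * (∫ P, ringDeficit L (fun _ => false) P * Real.exp (-(b * ringDeficit L (fun _ => false) P)) ∂(ringMeasure L)) /
        (∫ P, Real.exp (-(b * ringDeficit L (fun _ => false) P)) ∂(ringMeasure L))) atTop (𝓝 (9 * (L : ℝ) ^ 4 - 3 / 2)) := by
  obtain ⟨v, hv, hlim⟩ := periodicPrincipalLogLimit_fixedL L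
  exact tendsto_gibbsMean_of_principalLogLimit L hv hlim

end Summit.QuantumFields.YangMills.Theorems.SwapVirialDeficit.BlowUpRing

end
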